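import Literature.NumberTheory.LFunctions.WeilFirstPrimeCertificateDataC
import HarnessLib

/-!
# First-prime Weil positivity, stage C: kernel check of the even scaled moments ν_144, ν_146, ν_148, ν_150, ν_152, ν_154

Part of `weilCert3C.check` (`WeilFirstPrimeCertificateDataC.lean`), evaluated by `decide +kernel` and kept in its own
file for kernel time and memory (each declaration is checked separately). Assembled in
`WeilFirstPrimeCertificateCCheck.lean`. Pure proof file; nothing is asserted.
-/

noncomputable section

namespace Literature.NumberTheory.LFunctions

set_option maxHeartbeats 0 in
/-- **Kernel check of the scaled moment `ν_{144}`** of the stage-C first-prime certificate. [folklore] -/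
theorem checkNuAt144_weilCert3C : weilCert3C.checkNuAt 144 = true := by
  decide +kernel

set_option maxHeartbeats 0 in
/-- **Kernel check of the scaled moment `ν_{146}`** of the stage-C first-prime certificate. [folklore] -/
theorem checkNuAt146_weilCert3C : weilCert3C.checkNuAt 146 = true := by
  decide +kernel

set_option maxHeartbeats 0 in
/-- **Kernel check of the scaled moment `ν_{148}`** of the stage-C first-prime certificate. [folklore] -/
theorem checkNuAt148_weilCert3C : weilCert3C.checkNuAt 148 = true := by
  decide +kernel

set_option maxHeartbeats 0 in
/-- **Kernel check of the scaled moment `ν_{150}`** of the stage-C first-prime certificate. [folklore] -/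
theorem checkNuAt150_weilCert3C : weilCert3C.checkNuAt 150 = true := by
  decide +kernel

set_option maxHeartbeats 0 in
/-- **Kernel check of the scaled moment `ν_{152}`** of the stage-C first-prime certificate. [folklore] -/
theorem checkNuAt152_weilCert3C : weilCert3C.checkNuAt 152 = true := by
  decide +kernel

set_option maxHeartbeats 0 in
/-- **Kernel check of the scaled moment `ν_{154}`** of the stage-C first-prime certificate. [folklore] -/
theorem checkNuAt154_weilCert3C : weilCert3C.checkNuAt 154 = true := by
  decide +kernel

end Literature.NumberTheory.LFunctions
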